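import Mathlib.MeasureTheory.Integral.IntervalIntegral.Basic
import Literature.Barriers.Parity.SiegelZeroPrimePairs
import Literature.Barriers.Parity.SiegelZeroDichotomyNoSiegelZeros
import HarnessLib
import Summits.Parity.GeneralizedHardyLittlewood.Theorems.UnboundedSiegelZeros

/-!
# Goldbach representations and primes in almost all short intervals under a Siegel zero
# (Matomäki–Merikoski 2023, Theorem 1.4, Corollaries 1.2 and 1.5)

Statement layer for the «illusory world» column, topics «Goldbach» (I.6, with an EXIT) and «primes in
short intervals» (I.3). Source: K. Matomäki, J. Merikoski, *Siegel zeros, twin primes, Goldbach's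
conjecture, and primes in short intervals*, IMRN 2023, no. 23, 20337–20384 [MatomakiMerikoski2023];
held copy = arXiv:2112.11412 (tex), §1: Corollary 1.2, Theorem 1.4, Corollary 1.5 (the companions
Theorem 1.3 / Corollary 1.1 — pair correlations — are the tree's
`Literature.Barriers.Parity.MatomakiMerikoski2023_pairCorrelation` / `_fixedShift`, whose rendering
conventions this file copies: `β₀ = 1 − 1/(η log q)`, `η ≥ 10`, `q = 2^r q'`, the correction factor
`1_{φ(2^r) ∣ h} (−1)^{h/φ(2^r)} ∏_{p ∣ q', p ∤ h} (−1)/(p − 2)`, `V = log h/log q`).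

* `MatomakiMerikoski2023_goldbach` — NAMED FACT, Theorem 1.4 AS PRINTED: for `h ≥ q^{10}`,
  `∑_{n₁+n₂=h} Λ(n₁)Λ(n₂) = h𝔖_h (1 + χ(−1)·corr_q(h)) + O_{C,ε}((h/φ(h)) h (e^{−C√(V log η)} +
  e^{−C (log h)^{3/5−ε}} + V log⁶η/η))` (the Goldbach count is the tree's `goldbachLambdaCount`);
* `MatomakiMerikoski2023_corollary12` — NAMED FACT, Corollary 1.2 AS PRINTED (an EXIT): given
  `δ > 0` there is `η(δ) ≥ 100` such that ONE even `h ≡ 0 (mod q)` in `[q^{10}, q^{η^{99/100}}]`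
  with `δ𝔖_h h ≤ ∑ Λ(n₁)Λ(n₂) ≤ (2−δ)𝔖_h h` already excludes an exceptional zero
  `β₀ ≥ 1 − 1/(η log q)` of the primitive quadratic `χ` mod `q`;
* `MatomakiMerikoski2023_shortIntervals` — NAMED FACT, Corollary 1.5 AS PRINTED: the second moment
  `∫_X^{2X} (∑_{y<n≤y+H} Λ(n) − H)² dy ≪ HX log X + H²X(…)` for `X ≥ q^{10}`, `2 ≤ H ≤ X^{1/3}`
  («primes in almost all short intervals with `H/log X → ∞` … under the unlikely assumption of
  existence of Siegel zeros»);
* PROVED: **`MatomakiMerikoski2023.not_unboundedSiegelZeros_of_weakHLGoldbachConj`** — the tree's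
  Goldston–Suriajaya hypothesis `WeakHLGoldbachConj δ` (two-sided weak Goldbach for all large even
  `n`) meets Corollary 1.2 at `h = 2q^{10}` for every large conductor, hence bounds the quality of
  Siegel zeros by `η(δ)`: `¬ UnboundedSiegelZeros`, and **`.noSiegelZeros_of_weakHLGoldbachConj`**
  (⇒ the tree's open `NoSiegelZeros` via the PROVED `noSiegelZeros_of_not_unboundedSiegelZeros`) — a
  second published route (next to Friedlander–Iwaniec 2022 / FGIS,
  `WeakGoldbachExcludesExceptionalZeros.lean`) from the weak Goldbach bound to rh.S34, modulo the
  named fact.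

LABEL: instrument / statement layer. WHAT THIS IS NOT: no claim about Goldbach or about the
existence of Siegel zeros; nothing here bears on parity.

## References

* [MatomakiMerikoski2023] K. Matomäki, J. Merikoski, *Siegel zeros, twin primes, Goldbach's
  conjecture, and primes in short intervals*, Int. Math. Res. Not. IMRN 2023, no. 23, 20337–20384,
  doi:10.1093/imrn/rnad069 = arXiv:2112.11412: §1 Corollary 1.2, Theorem 1.4, Corollary 1.5 (and
  Theorem 1.3, Corollary 1.1 for the conventions).
* [GoldstonSuriajaya2021] D. A. Goldston, A. I. Suriajaya, arXiv:2104.09407, (5) (the tree's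
  `WeakHLGoldbachConj`).
* [TaoTeravainen2021] T. Tao, J. Teräväinen, JLMS 106 (2022), Definition 1.4 (`UnboundedSiegelZeros`).
-/

noncomputable section

open Finset Real
open scoped ArithmeticFunction.vonMangoldt
open Literature.Barriers.Parity Literature.NumberTheory.Sieve

namespace Literature.NumberTheory.LFunctions

/-- **Matomäki–Merikoski 2023, Theorem 1.4 (NAMED FACT, as printed).** «Let `C ≥ 1` and `ε > 0`.
Let `χ` be a primitive quadratic character modulo `q ≥ 2`. Write `q = 2^r q'` with `r ≥ 0` and
`2 ∤ q'`. Assume that `L(s,χ)` has a real zero `β₀` such that `β₀ = 1 − 1/(η log q)` for some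
`η ≥ 10`. Let `h ≥ q^{10}` be an integer. Writing `V := log h/log q ≥ 10`, we have
`∑_{n₁,n₂ ≤ h, n₁+n₂=h} Λ(n₁)Λ(n₂) = h𝔖_h (1 + χ(−1) 1_{φ(2^r)∣h} (−1)^{h/φ(2^r)} ∏_{p∣q', p∤h} (−1)/(p−2))
+ O_{C,ε}((h/φ(h)) h (exp(−C√(V log η)) + exp(−C(log h)^{3/5−ε}) + V(log η)⁶/η))`.» Rendered like
the tree's `MatomakiMerikoski2023_pairCorrelation` (`r = padicValNat 2 q`, `q' = q/2^r`,
`χ(−1)` as the real part of `χ(−1) ∈ {±1}`, the Goldbach count = `goldbachLambdaCount h`). Not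
proved here. [cite: MatomakiMerikoski2023, Theorem 1.4] -/
def MatomakiMerikoski2023_goldbach : Prop :=
  ∀ C : ℝ, 1 ≤ C → ∀ ε : ℝ, 0 < ε →
    ∃ K : ℝ, 0 < K ∧
      ∀ (q : ℕ) [NeZero q], 2 ≤ q → ∀ χ : DirichletCharacter ℂ q, χ.IsPrimitive → χ.IsQuadratic →
        ∀ η : ℝ, 10 ≤ η → χ.LFunction ((1 - 1 / (η * Real.log q) : ℝ) : ℂ) = 0 →
          ∀ h : ℕ, (q : ℝ) ^ (10 : ℝ) ≤ h →
            |goldbachLambdaCount h -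
                h * goldbachSingularSeries h *
                  (1 + (χ (-1)).re *
                    (if Nat.totient (2 ^ padicValNat 2 q) ∣ h then
                        (-1 : ℝ) ^ (h / Nat.totient (2 ^ padicValNat 2 q)) *
                          ∏ p ∈ (q / 2 ^ padicValNat 2 q).primeFactors.filter (fun p => ¬ p ∣ h),
                            (-1 : ℝ) / ((p : ℝ) - 2)
                      else 0))| ≤
              K * ((h : ℝ) / (Nat.totient h : ℝ)) * h *
                (Real.exp (-C * Real.sqrt (Real.log h / Real.log q * Real.log η)) +
                  Real.exp (-C * Real.log h ^ (3 / 5 - ε)) +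
                  Real.log h / Real.log q * Real.log η ^ (6 : ℕ) / η)

/-- **Matomäki–Merikoski 2023, Corollary 1.2 (NAMED FACT, as printed — an EXIT of the illusory
world).** «Let `δ > 0`. There exists `η = η(δ) ≥ 100` such that the following holds. Let `q ≥ 2` be
such that there exists a primitive quadratic character `χ (mod q)`. Assume that there exists an
even `h ∈ [q^{10}, q^{η^{99/100}}]` such that `q ∣ h` and
`δ𝔖_h·h ≤ ∑_{n₁+n₂=h} Λ(n₁)Λ(n₂) ≤ (2−δ)𝔖_h·h`. Then the Dirichlet `L`-function `L(s, χ)` does not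
have an exceptional zero `β₀` with `β₀ ≥ 1 − 1/(η log q)`.» (Rendered for every real
`β₀ ≥ 1 − 1/(η log q)`; for `β₀ ≥ 1` this is Mathlib's non-vanishing, `χ ≠ 1`.) «In fact … we only
need the lower bound if `χ(−1) = −1` and … only the upper bound if `χ(−1) = 1`» (not rendered). Not
proved here. [cite: MatomakiMerikoski2023, Corollary 1.2] -/
def MatomakiMerikoski2023_corollary12 : Prop :=
  ∀ δ : ℝ, 0 < δ → ∃ η : ℝ, 100 ≤ η ∧
    ∀ (q : ℕ) [NeZero q], 2 ≤ q → ∀ χ : DirichletCharacter ℂ q, χ.IsPrimitive → χ.IsQuadratic →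
      (∃ h : ℕ, Even h ∧ q ∣ h ∧ (q : ℝ) ^ (10 : ℝ) ≤ h ∧ (h : ℝ) ≤ (q : ℝ) ^ (η ^ (99 / 100 : ℝ)) ∧
          δ * (goldbachSingularSeries h * h) ≤ goldbachLambdaCount h ∧
          goldbachLambdaCount h ≤ (2 - δ) * (goldbachSingularSeries h * h)) →
      ∀ β₀ : ℝ, 1 - 1 / (η * Real.log q) ≤ β₀ → χ.LFunction (β₀ : ℂ) ≠ 0

/-- **Matomäki–Merikoski 2023, Corollary 1.5 (NAMED FACT, as printed).** «Let `C ≥ 2` and `ε > 0`.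
Let `χ` be a primitive quadratic character modulo `q ≥ 2` and assume that `L(s,χ)` has a real zero
`β₀ = 1 − 1/(η log q)` for some `η ≥ 10`. Let `X ≥ q^{10}`, write `V := log X/log q ≥ 10`, and let
`2 ≤ H ≤ X^{1/3}`. Then
`∫_X^{2X} (∑_{y<n≤y+H} Λ(n) − H)² dy ≪_{C,ε} HX log X + H²X (exp(−C√(V log η)) +
exp(−C(log X)^{3/5−ε}) + V log⁶η/η)`.» (For integers `n`, `y < n ≤ y + H` iff `⌊y⌋ < n ≤ ⌊y+H⌋`.)
«This implies that as soon as `η → ∞`, `H/log X → ∞`, and `q^{10} ≤ X ≤ q^{η^{1−δ}}`, we get the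
asymptotic formula for almost all `y`» (not rendered). Not proved here.
[cite: MatomakiMerikoski2023, Corollary 1.5] -/
def MatomakiMerikoski2023_shortIntervals : Prop :=
  ∀ C : ℝ, 2 ≤ C → ∀ ε : ℝ, 0 < ε →
    ∃ K : ℝ, 0 < K ∧
      ∀ (q : ℕ) [NeZero q], 2 ≤ q → ∀ χ : DirichletCharacter ℂ q, χ.IsPrimitive → χ.IsQuadratic →
        ∀ η : ℝ, 10 ≤ η → χ.LFunction ((1 - 1 / (η * Real.log q) : ℝ) : ℂ) = 0 →
          ∀ X H : ℝ, (q : ℝ) ^ (10 : ℝ) ≤ X → 2 ≤ H → H ≤ X ^ ((1 : ℝ) / 3) →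
            ∫ y in X..(2 * X), (∑ n ∈ Finset.Ioc ⌊y⌋₊ ⌊y + H⌋₊, Λ n - H) ^ 2 ≤
              K * (H * X * Real.log X +
                H ^ 2 * X * (Real.exp (-C * Real.sqrt (Real.log X / Real.log q * Real.log η)) +
                  Real.exp (-C * Real.log X ^ (3 / 5 - ε)) +
                  Real.log X / Real.log q * Real.log η ^ (6 : ℕ) / η))

namespace MatomakiMerikoski2023

/-! ### PROVED: the weak Goldbach bound bounds the quality of Siegel zeros (via Corollary 1.2) -/

/-- `11 ≤ η^{99/100}` for `η ≥ 100` (`11⁴ ≤ 100³` and `η^{99/100} ≥ η^{3/4}`). [folklore] -/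
private theorem eleven_le_rpow {η : ℝ} (hη : 100 ≤ η) : (11 : ℝ) ≤ η ^ (99 / 100 : ℝ) := by
  have hη1 : (1 : ℝ) ≤ η := by linarith
  have h34 : (11 : ℝ) ≤ η ^ (3 / 4 : ℝ) := by
    have h1 : (11 : ℝ) ^ (4 : ℕ) ≤ η ^ (3 : ℕ) := by
      have h100 : (100 : ℝ) ^ (3 : ℕ) ≤ η ^ (3 : ℕ) := pow_le_pow_left₀ (by norm_num) hη 3
      norm_num at h100 ⊢
      linarith
    have h0 : (0 : ℝ) ≤ 11 := by norm_num
    calc (11 : ℝ) = ((11 : ℝ) ^ (4 : ℕ)) ^ ((4 : ℕ) : ℝ)⁻¹ :=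
          (Real.pow_rpow_inv_natCast h0 (by norm_num)).symm
      _ ≤ (η ^ (3 : ℕ)) ^ ((4 : ℕ) : ℝ)⁻¹ := Real.rpow_le_rpow (by positivity) h1 (by positivity)
      _ = η ^ (3 / 4 : ℝ) := by
          rw [← Real.rpow_natCast, ← Real.rpow_mul (by linarith)]; norm_num
  exact h34.trans (Real.rpow_le_rpow_of_exponent_le hη1 (by norm_num))

/-- **The weak Goldbach bound excludes Siegel zeros of unbounded quality, modulo Corollary 1.2.**
Under the tree's `WeakHLGoldbachConj δ` (two-sided weak Goldbach for ALL large even `n`,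
Goldston–Suriajaya (5)), every large conductor `q` carrying a primitive quadratic `χ` satisfies the
hypothesis of Corollary 1.2 at `h = 2q^{10}` (even, `q ∣ h`, `q^{10} ≤ h ≤ q^{11} ≤ q^{η^{99/100}}`),
so `L(s,χ)` has no real zero `≥ 1 − 1/(η(δ) log q)`: the quality of Siegel zeros at large conductors
is `< η(δ)`, contradicting `UnboundedSiegelZeros`. [cite: MatomakiMerikoski2023, Corollary 1.2]
[cite: GoldstonSuriajaya2021, (5)] -/
theorem not_unboundedSiegelZeros_of_weakHLGoldbachConj (h : MatomakiMerikoski2023_corollary12)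
    {δ : ℝ} (hδ : 0 < δ) (hG : WeakHLGoldbachConj δ) : ¬ Summit.Parity.GeneralizedHardyLittlewood.UnboundedSiegelZeros := by
  intro hU
  obtain ⟨η, hη100, hmain⟩ := h δ hδ
  obtain ⟨n₀, hn₀⟩ := hG
  obtain ⟨q, hqne, χ, ηT, hq, hηT, hSZ⟩ := hU η (max n₀ 2)
  haveI := hqne
  obtain ⟨hprim, hquad, h10, hzero⟩ := hSZ
  have hq2 : 2 ≤ q := le_trans (le_max_right _ _) hq
  have hqn₀ : n₀ ≤ q := le_trans (le_max_left _ _) hq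
  have hq2r : (2 : ℝ) ≤ q := by exact_mod_cast hq2
  have hq1r : (1 : ℝ) ≤ q := by linarith
  have hqpos : (0 : ℝ) < q := by linarith
  have hlogq : 0 < Real.log q := Real.log_pos (by linarith)
  have hηpos : 0 < η := by linarith
  have hηTpos : 0 < ηT := by linarith
  -- the test shift `h = 2 q^10`
  set hh : ℕ := 2 * q ^ 10 with hhdef
  have heven : Even hh := ⟨q ^ 10, by rw [hhdef]; ring⟩
  have hdvd : q ∣ hh := Dvd.dvd.mul_left (dvd_pow_self q (by norm_num)) 2
  have hq10 : (q : ℝ) ^ (10 : ℝ) ≤ hh := by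
    rw [hhdef]; push_cast
    rw [show (10 : ℝ) = ((10 : ℕ) : ℝ) by norm_num, Real.rpow_natCast]
    nlinarith [pow_pos hqpos 10]
  have hupper : (hh : ℝ) ≤ (q : ℝ) ^ (η ^ (99 / 100 : ℝ)) := by
    have h11 : (hh : ℝ) ≤ (q : ℝ) ^ (11 : ℝ) := by
      rw [hhdef]; push_cast
      rw [show (11 : ℝ) = ((11 : ℕ) : ℝ) by norm_num, Real.rpow_natCast]
      have : (q : ℝ) ^ 11 = q * (q : ℝ) ^ 10 := by ring
      rw [this]
      nlinarith [pow_pos hqpos 10]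
    exact h11.trans (Real.rpow_le_rpow_of_exponent_le hq1r (eleven_le_rpow hη100))
  have hn₀h : n₀ ≤ hh := by
    calc n₀ ≤ q := hqn₀
      _ ≤ q ^ 10 := by
          calc q = q ^ 1 := (pow_one q).symm
            _ ≤ q ^ 10 := Nat.pow_le_pow_right (by omega) (by norm_num)
      _ ≤ 2 * q ^ 10 := by omega
  obtain ⟨hlo, hhi⟩ := hn₀ hh hn₀h heven
  have hyp : ∃ h : ℕ, Even h ∧ q ∣ h ∧ (q : ℝ) ^ (10 : ℝ) ≤ h ∧
      (h : ℝ) ≤ (q : ℝ) ^ (η ^ (99 / 100 : ℝ)) ∧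
      δ * (goldbachSingularSeries h * h) ≤ goldbachLambdaCount h ∧
      goldbachLambdaCount h ≤ (2 - δ) * (goldbachSingularSeries h * h) :=
    ⟨hh, heven, hdvd, hq10, hupper, hlo, hhi⟩
  -- the Siegel zero `1 − 1/(ηT log q)` has `ηT ≥ η`, hence lies above `1 − 1/(η log q)`
  have hβ : 1 - 1 / (η * Real.log q) ≤ 1 - 1 / (ηT * Real.log q) := by
    have : 1 / (ηT * Real.log q) ≤ 1 / (η * Real.log q) :=
      one_div_le_one_div_of_le (by positivity) (by nlinarith)
    linarith
  exact hmain q hq2 χ hprim hquad hyp (1 - 1 / (ηT * Real.log q)) hβ hzero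

/-- **Exit on rh.S34**: the weak Goldbach bound in the tree's form (`WeakHLGoldbachConj δ`, some
`δ > 0`) implies `NoSiegelZeros`, modulo Corollary 1.2 — by the PROVED
`noSiegelZeros_of_not_unboundedSiegelZeros`. A second published route to the conclusion of
`FriedlanderIwaniec2022.noSiegelZeros_of_weakHLGoldbachConj` (which needs the bound for all large
even `n`; Corollary 1.2 needs ONE `h ≡ 0 (mod q)` per conductor). [cite: MatomakiMerikoski2023, Corollary 1.2] -/
theorem noSiegelZeros_of_weakHLGoldbachConj (h : MatomakiMerikoski2023_corollary12) {δ : ℝ}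
    (hδ : 0 < δ) (hG : WeakHLGoldbachConj δ) : NoSiegelZeros :=
  noSiegelZeros_of_not_unboundedSiegelZeros (not_unboundedSiegelZeros_of_weakHLGoldbachConj h hδ hG)

end MatomakiMerikoski2023

end Literature.NumberTheory.LFunctions

end
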